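import Literature.NumberTheory.Transcendental.KaehlerIdentityAssemblyProofs
import Literature.NumberTheory.Transcendental.KaehlerHodgeDolbeaultHarmonicProofs
import Literature.NumberTheory.Transcendental.DolbeaultProofs
import Literature.NumberTheory.Transcendental.KaehlerHodgePreHilbert
import Literature.NumberTheory.Transcendental.KaehlerHodgeStarStarProofs
import Literature.Geometry.Kaehler.KaehlerSymbolIdentityProofs

/-!
# `∂α = 0` for `∂̄`-harmonic forms on a compact Kähler manifold (from `[∂̄*, L] = i∂`)

Consequence of the Kähler identity `∂̄*(Lα) - L(∂̄*α) - i∂α = 0`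
(`kaehlerP_apply_eq_zero`, Voisin (2002), Prop. 6.5): on a compact Kähler manifold, a smooth form
with `∂̄α = 0` and `∂̄*α = 0` has `∂α = 0` (`dolbeault_eq_zero_of_dolbeaultBar_harmonic`):
`i∂α = ∂̄*(Lα)`, so `‖∂α‖² = ⟪∂̄(i∂α), Lα⟫ = 0` because `∂̄∂α = -∂∂̄α = 0`
(`MForm.cl2Inner_dolbeaultBar_left_of_isHermitian`, `dolbeault_dolbeaultBar_add_dolbeaultBar_dolbeault`,
positivity `eq_zero_of_cl2Inner_self_eq_zero`). The same on functions
(`dolbeault_eq_zero_of_dolbeaultBar_eq_zero_zero`). This is the step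
"`∂̄`-harmonic ⇒ `∂`-closed" of Voisin (2002), §6.1.2 (Thm. 6.7 ⇒ Cor. 6.10), obtained here
directly from the first-order identity.

## References

* C. Voisin, *Hodge Theory and Complex Algebraic Geometry I* (2002), §6.1.1 Prop. 6.5, §6.1.2
  Cor. 6.10. [Voisin2002]
-/

noncomputable section

open scoped Manifold ContDiff Topology RealInnerProductSpace ComplexConjugate
open Set Function Bundle Module Filter ContinuousAlternatingMap Complex
open Literature.Geometry.Kaehler

namespace Literature.NumberTheory.Transcendental

set_option quotPrecheck false

section Helpers

variable {E : Type*} [NormedAddCommGroup E] [NormedSpace ℂ E] [FiniteDimensional ℂ E]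
  {M : Type*} [TopologicalSpace M] [ChartedSpace E M] {n : ℕ} [Fact (finrank ℝ E = n)]
  [RiemannianBundle (fun x : M ↦ TangentSpace 𝓘(ℝ, E) x)]
  (o : (x : M) → Orientation ℝ (TangentSpace 𝓘(ℝ, E) x) (Fin n))

/-- `⋆(iβ) = i⋆β` for the `ℂ`-linear Hodge star on forms. [folklore] -/
theorem cHodgeStar_I_smul {k m : ℕ} (h : k + m = n) (β : MForm 𝓘(ℝ, E) M ℂ k) :
    MForm.cHodgeStar o h (I • β) = I • MForm.cHodgeStar o h β :=
  funext fun x ↦ cHodgeStarPt_I_smul (o x) h (β x)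

end Helpers

section Vanishing

variable {E : Type*} [NormedAddCommGroup E] [NormedSpace ℂ E] [FiniteDimensional ℂ E]
  {M : Type*} [TopologicalSpace M] [ChartedSpace E M] [IsManifold 𝓘(ℝ, E) ∞ M]
  [IsManifold 𝓘(ℂ, E) ω M] [T2Space M] [CompactSpace M] {n : ℕ} [Fact (finrank ℝ E = n)]
  [RiemannianBundle (fun x : M ↦ TangentSpace 𝓘(ℝ, E) x)]
  [IsContinuousRiemannianBundle E (fun x : M ↦ TangentSpace 𝓘(ℝ, E) x)]
  [IsContMDiffRiemannianBundle 𝓘(ℝ, E) ∞ E (fun x : M ↦ TangentSpace 𝓘(ℝ, E) x)]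
  (o : (x : M) → Orientation ℝ (TangentSpace 𝓘(ℝ, E) x) (Fin n))

set_option hygiene false in
/-- The covector family of the model Lefschetz operator. -/
local notation "θE[" B' "]" => (2⁻¹ : ℝ) • ContinuousLinearMap.comp B'
  ((Complex.I • ContinuousLinearMap.id ℂ E).restrictScalars ℝ)

set_option hygiene false in
/-- The canonical family of the model Lefschetz operator. -/
local notation "LfamE[" B' "]" η:max =>
  ContinuousLinearMap.comp (ContinuousAlternatingMap.alternatizeUncurryFinCLM ℝ E ℂ)
    (ContinuousLinearMap.comp (ContinuousLinearMap.flip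
      (ContinuousLinearMap.smulRightL ℝ E (E [⋀^Fin _]→L[ℝ] ℂ)) η) (θE[B']))

set_option hygiene false in
/-- The model Lefschetz operator. -/
local notation "LopE[" B' "]" η:max =>
  ContinuousAlternatingMap.alternatizeUncurryFin (𝕜 := ℝ) (E := E) (F := ℂ) (LfamE[B'] η)

set_option hygiene false in
/-- The Lefschetz operator on forms on `M`. -/
local notation "Lform[" G' "]" β:max =>
  @id (MForm 𝓘(ℝ, E) M ℂ (_ + 1 + 1)) (fun x ↦ (LopE[G' x] (β x) :))

omit [IsManifold 𝓘(ℂ, E) ω M] [IsContinuousRiemannianBundle E fun x : M ↦ TangentSpace 𝓘(ℝ, E) x]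
  [IsContMDiffRiemannianBundle 𝓘(ℝ, E) ∞ E fun x : M ↦ TangentSpace 𝓘(ℝ, E) x] in
/-- `⟪ᾱ, β̄⟫ = conj ⟪α, β⟫` for the Hermitian `L²` product. [folklore] -/
theorem cl2Inner_conj_conj [MeasurableSpace E] [BorelSpace E] {k : ℕ}
    (α β : MForm 𝓘(ℝ, E) M ℂ k) :
    MForm.cl2Inner o α.conj β.conj = conj (MForm.cl2Inner o α β) := by
  have hre : ∀ γ : MForm 𝓘(ℝ, E) M ℂ k, γ.conj.re = γ.re := fun γ ↦ by
    funext x; ext v; simp [MForm.re_apply]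
  have him : ∀ γ : MForm 𝓘(ℝ, E) M ℂ k, γ.conj.im = -γ.im := fun γ ↦ by
    funext x; ext v; simp [MForm.im_apply]
  simp only [MForm.cl2Inner, hre, him, MForm.l2Inner_neg_left,
    MForm.l2Inner_neg_right, map_add, map_mul, Complex.conj_ofReal, Complex.conj_I]
  push_cast
  ring

set_option maxHeartbeats 800000 in
/-- **`∂̄`-closed and `∂̄*`-closed ⇒ `∂`-closed on a compact Kähler manifold**, degrees `k + 1` with
`k + 3 ≤ n`: for a smooth `(k+1)`-form `α` with `∂̄α = 0` and `∂̄*α = 0`, `∂α = 0`. From the Kähler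
identity `∂̄*(Lα) = i∂α + L(∂̄*α) = i∂α` and `‖i∂α‖² = ⟪∂̄(i∂α), Lα⟫ = ⟪-i∂∂̄α, Lα⟫ = 0`.
Voisin (2002), §6.1.2 (proof of Thm. 6.7 / Cor. 6.10). [cite: Voisin2002, §6.1.2 Cor. 6.10] -/
theorem dolbeault_eq_zero_of_dolbeaultBar_harmonic
    (hJ : ∀ (x : M) (v w : TangentSpace 𝓘(ℝ, E) x), ⟪tangentJ E x v, tangentJ E x w⟫ = ⟪v, w⟫)
    (ho : IsSmoothForm (riemannianVolumeForm o))
    (G : M → E →L[ℝ] E →L[ℝ] ℝ) (hG : ∀ (x : M) (v w : TangentSpace 𝓘(ℝ, E) x), G x v w = ⟪v, w⟫)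
    (hH : ∀ x v w, G x (Complex.I • v) (Complex.I • w) = G x v w)
    (hK : IsClosedForm (RiemannianBundle.g (E := fun x : M ↦ TangentSpace 𝓘(ℝ, E) x)).kaehlerForm)
    {k m₁ m₃ : ℕ} (h₁ : (k + 1 + 1 + 1) + m₁ = n) (h₃ : (k + 1) + m₃ = n)
    {α : MForm 𝓘(ℝ, E) M ℂ (k + 1)} (hα : IsSmoothForm α) (hdb : dolbeaultBar α = 0)
    (hadj : dolbeaultBarAdjoint o h₃ α = 0) : dolbeault α = 0 := by
  letI : MeasurableSpace E := borel E
  haveI : BorelSpace E := ⟨rfl⟩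
  -- the Kähler identity as an identity of forms: `∂̄*(Lα) = i∂α`
  have TL : dolbeaultBarAdjoint o h₁ (Lform[G] α) = I • dolbeault α := by
    have h0 : (dolbeaultBarAdjoint o h₁ (Lform[G] α) - Lform[G] (dolbeaultBarAdjoint o h₃ α) -
        I • dolbeault α) = 0 :=
      funext fun x ↦ kaehlerP_apply_eq_zero o ho G hG hH hK h₁ h₃ α hα x
    rw [hadj, lform_zero, sub_zero, sub_eq_zero] at h0
    exact h0
  have hγs : IsSmoothForm (I • dolbeault α) :=
    (mem_csmoothForms_iff _).1 ((csmoothForms E M (k + 1 + 1)).smul_mem I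
      (mem_csmoothForms hα.dolbeault))
  have hL : IsSmoothForm (Lform[G] α) := isSmoothForm_lform G hG hα
  -- `∂̄(i∂α) = -i∂∂̄α = 0`
  have hdbγ : dolbeaultBar (I • dolbeault α) = 0 := by
    have h2 := dolbeault_dolbeaultBar_add_dolbeaultBar_dolbeault_holds hα
    rw [hdb, dolbeault_zero] at h2
    rw [dolbeaultBar_smul_holds I, (zero_add (dolbeaultBar (dolbeault α))).symm.trans h2, smul_zero]
  -- `⟪i∂α, i∂α⟫ = ⟪∂̄(i∂α), Lα⟫ = 0`
  have hadjoint := MForm.cl2Inner_dolbeaultBar_left_of_isHermitian o hJ ho h₁ hγs hL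
  rw [hdbγ, MForm.cl2Inner_zero_left, TL] at hadjoint
  have hγ0 : I • dolbeault α = 0 :=
    eq_zero_of_cl2Inner_self_eq_zero o ho (show (k + 1 + 1) + (m₁ + 1) = n by omega) hγs
      hadjoint.symm
  have h3 := congrArg (fun β : MForm 𝓘(ℝ, E) M ℂ (k + 1 + 1) ↦ (-I) • β) hγ0
  simpa [smul_smul] using h3

set_option maxHeartbeats 800000 in
/-- **`∂̄`-closed functions are `∂`-closed on a compact Kähler manifold** (`n ≥ 2`): for a smooth
function `α` with `∂̄α = 0`, `∂α = 0`, from `∂̄*(Lα) = i∂α` (`kaehlerP_apply_eq_zero_zero`) as in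
`dolbeault_eq_zero_of_dolbeaultBar_harmonic`. [cite: Voisin2002, §6.1.2 Cor. 6.10] -/
theorem dolbeault_eq_zero_of_dolbeaultBar_eq_zero_zero
    (hJ : ∀ (x : M) (v w : TangentSpace 𝓘(ℝ, E) x), ⟪tangentJ E x v, tangentJ E x w⟫ = ⟪v, w⟫)
    (ho : IsSmoothForm (riemannianVolumeForm o))
    (G : M → E →L[ℝ] E →L[ℝ] ℝ) (hG : ∀ (x : M) (v w : TangentSpace 𝓘(ℝ, E) x), G x v w = ⟪v, w⟫)
    (hH : ∀ x v w, G x (Complex.I • v) (Complex.I • w) = G x v w)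
    (hK : IsClosedForm (RiemannianBundle.g (E := fun x : M ↦ TangentSpace 𝓘(ℝ, E) x)).kaehlerForm)
    {m₁ : ℕ} (h₁ : (0 + 1 + 1) + m₁ = n) {α : MForm 𝓘(ℝ, E) M ℂ 0} (hα : IsSmoothForm α)
    (hdb : dolbeaultBar α = 0) : dolbeault α = 0 := by
  letI : MeasurableSpace E := borel E
  haveI : BorelSpace E := ⟨rfl⟩
  have TL : dolbeaultBarAdjoint o h₁ (Lform[G] α) = I • dolbeault α := by
    have h0 : (dolbeaultBarAdjoint o h₁ (Lform[G] α) - I • dolbeault α) = 0 :=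
      funext fun x ↦ kaehlerP_apply_eq_zero_zero o ho G hG hH hK h₁ α hα x
    exact sub_eq_zero.1 h0
  have hγs : IsSmoothForm (I • dolbeault α) :=
    (mem_csmoothForms_iff _).1 ((csmoothForms E M (0 + 1)).smul_mem I
      (mem_csmoothForms hα.dolbeault))
  have hL : IsSmoothForm (Lform[G] α) := isSmoothForm_lform G hG hα
  have hdbγ : dolbeaultBar (I • dolbeault α) = 0 := by
    have h2 := dolbeault_dolbeaultBar_add_dolbeaultBar_dolbeault_holds hα
    rw [hdb, dolbeault_zero] at h2
    rw [dolbeaultBar_smul_holds I, (zero_add (dolbeaultBar (dolbeault α))).symm.trans h2, smul_zero]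
  have hadjoint := MForm.cl2Inner_dolbeaultBar_left_of_isHermitian o hJ ho h₁ hγs hL
  rw [hdbγ, MForm.cl2Inner_zero_left, TL] at hadjoint
  have hγ0 : I • dolbeault α = 0 :=
    eq_zero_of_cl2Inner_self_eq_zero o ho (show (0 + 1) + (m₁ + 1) = n by omega) hγs
      hadjoint.symm
  have h3 := congrArg (fun β : MForm 𝓘(ℝ, E) M ℂ (0 + 1) ↦ (-I) • β) hγ0
  simpa [smul_smul] using h3

/-! #### The edge degree `n - 1` -/

set_option maxHeartbeats 1600000 in
/-- **`∂̄`-closed and `∂̄*`-closed ⇒ `∂`-closed, edge degree `n - 1`.** For a smooth `(k+1)`-form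
`α` with `(k + 1) + 1 = n` and `∂̄*α = 0` (here `∂̄α = 0` is not even needed), again `∂α = 0`; `Lα` would be of degree
`n + 1` and the identity is used on *functions* instead, by duality: with `θ = ∂α` (a top form),
`‖θ‖² = conj ⟪∂̄ᾱ, θ̄⟫ = conj ⟪ᾱ, ∂̄*θ̄⟫`, `∂̄*θ̄ = -⋆∂φ` for the function `φ = ⋆θ̄`, and by the
Kähler identity on functions `∂φ = -i∂̄*(Lφ) = i⋆∂χ` with `χ = ⋆Lφ`, so that
`⟪ᾱ, ∂̄*θ̄⟫ ∝ ⟪ᾱ, ∂χ⟫ = conj ⟪α, ∂̄χ̄⟫ ∝ ⟪χ̄, ∂̄*α⟫ = 0`. [cite: Voisin2002, §6.1.2 Cor. 6.10] -/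
theorem dolbeault_eq_zero_of_dolbeaultBar_harmonic_edge
    (hJ : ∀ (x : M) (v w : TangentSpace 𝓘(ℝ, E) x), ⟪tangentJ E x v, tangentJ E x w⟫ = ⟪v, w⟫)
    (ho : IsSmoothForm (riemannianVolumeForm o))
    (G : M → E →L[ℝ] E →L[ℝ] ℝ) (hG : ∀ (x : M) (v w : TangentSpace 𝓘(ℝ, E) x), G x v w = ⟪v, w⟫)
    (hH : ∀ x v w, G x (Complex.I • v) (Complex.I • w) = G x v w)
    (hK : IsClosedForm (RiemannianBundle.g (E := fun x : M ↦ TangentSpace 𝓘(ℝ, E) x)).kaehlerForm)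
    {k : ℕ} (h₃ : (k + 1) + 1 = n) {α : MForm 𝓘(ℝ, E) M ℂ (k + 1)} (hα : IsSmoothForm α)
    (hadj : dolbeaultBarAdjoint o h₃ α = 0) : dolbeault α = 0 := by
  letI : MeasurableSpace E := borel E
  haveI : BorelSpace E := ⟨rfl⟩
  have hn : (k + 1 + 1) + 0 = n := by omega
  have ha : (0 + 1) + (k + 1) = n := by omega
  have h₁ : (0 + 1 + 1) + k = n := by omega
  have hb : (k + 1) + (0 + 1) = n := by omega
  -- smoothness bookkeeping
  have hθ : IsSmoothForm (dolbeault α) := hα.dolbeault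
  have hθc : IsSmoothForm (dolbeault α).conj := isSmoothForm_conj hθ
  have hαc : IsSmoothForm α.conj := isSmoothForm_conj hα
  have hφ : IsSmoothForm (MForm.cHodgeStar o hn (dolbeault α).conj) := IsSmoothForm.cHodgeStar o ho hn hθc
  have hLφ : IsSmoothForm (Lform[G] (MForm.cHodgeStar o hn (dolbeault α).conj)) :=
    isSmoothForm_lform G hG hφ
  have hχ : IsSmoothForm (MForm.cHodgeStar o h₁ (Lform[G] (MForm.cHodgeStar o hn (dolbeault α).conj))) :=
    IsSmoothForm.cHodgeStar o ho h₁ hLφ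
  set χ := MForm.cHodgeStar o h₁ (Lform[G] (MForm.cHodgeStar o hn (dolbeault α).conj)) with hχdef
  have hχc : IsSmoothForm χ.conj := isSmoothForm_conj hχ
  have hdχ : IsSmoothForm (dolbeault χ) := hχ.dolbeault
  -- (1) `θ = conj (∂̄ ᾱ)`
  have e1 : dolbeault α = (dolbeaultBar α.conj).conj := by
    have := dolbeault_conj' α.conj
    rwa [MForm.conj_conj] at this
  -- (4) adjointness `⟪∂̄ᾱ, θ̄⟫ = ⟪ᾱ, ∂̄* θ̄⟫`
  have e4 := MForm.cl2Inner_dolbeaultBar_left_of_isHermitian o hJ ho hn hαc hθc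
  -- (5) `∂̄* θ̄ = -(I * s) • ∂χ` through the Kähler identity on the function `φ = ⋆θ̄`
  have TL : dolbeaultBarAdjoint o h₁ (Lform[G] (MForm.cHodgeStar o hn (dolbeault α).conj)) =
      I • dolbeault (MForm.cHodgeStar o hn (dolbeault α).conj) := by
    have h0 : (dolbeaultBarAdjoint o h₁ (Lform[G] (MForm.cHodgeStar o hn (dolbeault α).conj)) -
        I • dolbeault (MForm.cHodgeStar o hn (dolbeault α).conj)) = 0 :=
      funext fun x ↦ kaehlerP_apply_eq_zero_zero o ho G hG hH hK h₁ _ hφ x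
    exact sub_eq_zero.1 h0
  have e5 : dolbeaultBarAdjoint o hn (dolbeault α).conj =
      -(I • (((-1 : ℂ) ^ ((k + 1) * (0 + 1))) • dolbeault χ)) := by
    -- `∂φ = (-I) • ∂̄*(Lφ) = (-I) • (-⋆∂χ)`
    have hdφ : dolbeault (MForm.cHodgeStar o hn (dolbeault α).conj) =
        (-I) • dolbeaultBarAdjoint o h₁ (Lform[G] (MForm.cHodgeStar o hn (dolbeault α).conj)) := by
      rw [TL, smul_smul]
      simp
    have hdef₁ : dolbeaultBarAdjoint o h₁ (Lform[G] (MForm.cHodgeStar o hn (dolbeault α).conj)) =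
        -MForm.cHodgeStar o hb (dolbeault χ) := rfl
    have hdef₂ : dolbeaultBarAdjoint o hn (dolbeault α).conj =
        -MForm.cHodgeStar o ha (dolbeault (MForm.cHodgeStar o hn (dolbeault α).conj)) := rfl
    rw [hdef₂, hdφ, hdef₁, smul_neg, neg_smul, neg_neg, cHodgeStar_I_smul o ha,
      MForm.cHodgeStar_cHodgeStar_holds o hb ha (dolbeault χ)]
  -- (6)-(7) `⟪ᾱ, ∂χ⟫ = 0`
  have e7 : MForm.cl2Inner o α.conj (dolbeault χ) = 0 := by
    have hc : dolbeault χ = (dolbeaultBar χ.conj).conj := by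
      have := dolbeault_conj' χ.conj
      rwa [MForm.conj_conj] at this
    have hadj' := MForm.cl2Inner_dolbeaultBar_left_of_isHermitian o hJ ho h₃ hχc hα
    rw [hadj, MForm.cl2Inner_zero_right] at hadj'
    rw [hc, cl2Inner_conj_conj o, ← MForm.cl2Inner_conj_symm o (dolbeaultBar χ.conj) α, hadj',
      _root_.map_zero, _root_.map_zero]
  -- assemble `⟪θ, θ⟫ = 0`
  have hsmooth : IsSmoothForm (((-1 : ℂ) ^ ((k + 1) * (0 + 1))) • dolbeault χ) :=
    (mem_csmoothForms_iff _).1 ((csmoothForms E M (k + 1)).smul_mem _ (mem_csmoothForms hdχ))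
  have e8 : MForm.cl2Inner o α.conj (dolbeaultBarAdjoint o hn (dolbeault α).conj) = 0 := by
    rw [e5, MForm.cl2Inner_neg_right,
      hαc.cl2Inner_smul_right o I hsmooth ho, hαc.cl2Inner_smul_right o _ hdχ ho, e7]
    simp
  have hzero : MForm.cl2Inner o (dolbeault α) (dolbeault α) = 0 := by
    have h9 := cl2Inner_conj_conj o (dolbeaultBar α.conj) (dolbeault α).conj
    rw [MForm.conj_conj, ← e1] at h9
    rw [h9, e4, e8, _root_.map_zero]
  exact eq_zero_of_cl2Inner_self_eq_zero o ho hn hθ hzero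

omit [IsManifold 𝓘(ℝ, E) ∞ M] [IsManifold 𝓘(ℂ, E) ω M] [T2Space M] [CompactSpace M]
  [RiemannianBundle fun x : M ↦ TangentSpace 𝓘(ℝ, E) x]
  [IsContinuousRiemannianBundle E fun x : M ↦ TangentSpace 𝓘(ℝ, E) x]
  [IsContMDiffRiemannianBundle 𝓘(ℝ, E) ∞ E fun x : M ↦ TangentSpace 𝓘(ℝ, E) x] in
/-- **`∂α = 0` in the top degree** (`(k + 1) = n`): forms of degree `n + 1` vanish. [folklore] -/
theorem dolbeault_eq_zero_of_top {k : ℕ} (h₃ : (k + 1) + 0 = n) (α : MForm 𝓘(ℝ, E) M ℂ (k + 1)) :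
    dolbeault α = 0 :=
  cform_eq_zero_of_finrank_lt (n := n) (by omega) _

end Vanishing

end Literature.NumberTheory.Transcendental
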